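import Summits.QuantumFields.BalabanUV.T4Continuum.Support.NE3CovariantLineAdjointFrame
import Summits.QuantumFields.BalabanUV.T4Continuum.Support.NE3LandauOrbit
import Summits.QuantumFields.BalabanUV.T4Continuum.Support.NE3FrameFreeDecompositionPrep
import Summits.QuantumFields.BalabanUV.T4Continuum.Support.NE7LineSumGramBounds
import Summits.QuantumFields.BalabanUV.T4Continuum.Support.AveragingDeficitHSInner

/-!
# NE7CombLineSumGramBounds — (α_S) OF THE ENERGY ROAD AT ANY UNITARY BACKGROUND, EXACTLY: the Gram form of the adjoint of the κ-LAST COMB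
# LINE SUM `TWg M (combFrame W M)` (NE3 K4-a) has the FLAT two-sided symbol, `M^{d−1}·M(M²+2)∕3·Σ‖ω‖² ≤ Σ_xΣ_κ ‖WadWg M (combFrame W M) ω x κ‖²
# ≤ M^{d−1}·M³·Σ‖ω‖²`, for EVERY unitary `W` (no small field, no gauge fixing); hence `λ`-coercivity on `(ker)ᗮ` and `Λ²∕λ ≤ 3` on the torus 1-forms

Cell `pub-balaban`, rung (B)+1 sub-cell t4, lineage `b2b-balaban-t4-ne7-p1`, generation 63 (CRUX PROVER NE7 #1, ruling e34b3e0c (2)); hunt (h7)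
«ENERGY ROAD», memo v2 §6 (`t4/b2b-balaban-t4-ne7-p1-g62/HUNT-H7-ENERGY-ROAD-v2.md`).  After gen 62 the residual of (E3″)
(`NE7TensionKernelCoercivity.normSq_le_of_exact_annihilator`: `‖T‖² ≤ 4‖ST‖²∕λ + (4Λ²∕λ + 2)θ₀²`) was (α_S) two-sided Gram bounds for the straight
linearised average at the CURVED background (flat symbol `[M(M²+2)∕3, M³]` per line: `NE7LineSumGramBounds`; abstract link: `NE7AdjointGramCoercivity`),
(β_S), the perturbation `QbarIter ≈ S`, identification, (8).  THIS FILE takes for `S` the NE3 swarm's covariant block-line sum of record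
`TWg M (combFrame W M)` (K4-a `NE3CovariantLineAdjoint{,Frame}`: copies carried to the corner along the `κ`-LAST comb word; exact torus adjoint `WadWg`
at ANY unitary `W`).  OBSERVATION (§2): all the copies through a fine bond `(x,κ)` from one block carry THE SAME comb word (`treeWord (r − r_κe_κ) ++
seg κ (r_κ+1)`, `klastWord_sub_smul_succ`), so (§3 `WadWg_combFrame_eq`) `WadWg M (combFrame W M) ω x κ = (r_κ+1)•Ad_{A⁻¹} ω(z,κ) + (M−1−r_κ)•Ad_{B⁻¹}
ω(z−e_κ,κ)` with two unitaries; `‖Ad_u X‖_HS = ‖X‖_HS` makes gen 62's pointwise AM–GM step go through with an isometric twist (§1, §4), and the torus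
bookkeeping (§5: transverse count `M^{d−1}`, block tiling, coarse periodic shift, weight sums `M(M+1)(M+2)∕6 + M(M−1)(M−2)∕6 = M(M²+2)∕3`,
`M·M(M+1)∕2 + M·M(M−1)∕2 = M³`) gives §6 **`sum_nhsNormSq_WadWg_combFrame_lower`** ∕ **`…_upper`** for EVERY unitary `W`, `N`-periodic `ω`, `M, N ≥ 1`
— the flat symbol is EXACT at a curved background: (α_S) needs NO smallness and NO perturbation.  The companion file `NE7CombLineSumCoercive`
packages it on `NE3HilbertSchmidtTorus.Form` (the comb line sum as a CLM, its adjoint `= resF ∘ WadWg ∘ extF` by K4-a's identity, `λ`-coercivity on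
`(ker)ᗮ` and `‖S v‖ ≤ √(M^{d−1}·M³)‖v‖` via gen 62's `NE7AdjointGramCoercivity`).  WHAT REMAINS for (E3″): (β_S) for the same `S`, the perturbation
`‖QbarIter k W − M^{−d}•TWc‖` (NE3 C1 tower), identification (h7-e), (8) interiority.
HONEST FRAMING (page 1): finite-dimensional linear algebra ∕ lattice bookkeeping on the NE3 swarm's typed objects at ONE unitary background; nothing about
Bałaban's minimisers; NE7, NE3 NOT PRINTED in [Balaban1984PropagatorsI]–[Balaban1989LargeFieldII] and NOT PROVED; FIXED FINITE torus, rung (B)+1;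
continuum YM on T⁴ ⇐ BetaPertH ∧ nine spine estimates (0/9 proved); BetaPertH ⇐ (D1) ∧ (D4) ∧ CAP+tail; G-an2-4 gates asym, D1 and NE2/3/4; NOT infinite
volume, NOT mass gap, NOT Clay.  0 def, 0 sorry.
-/

set_option autoImplicit false

open scoped BigOperators Matrix Matrix.Norms.L2Operator
open Finset

namespace Summit.QuantumFields.BalabanUV.T4Continuum.NE7CombLineSumGramBounds

open Literature.MathematicalPhysics.QuantumFieldTheory.Balaban1983to89
open B7Prop1Explicit B7Prop2Explicit MatrixNorms UnitaryModel
open T4AveragingDeficitWall (IsUnitaryCfg Ad)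
open T4AveragingDeficitWallBoundary (periodBox mem_periodBox IsPeriodicCfg sum_periodBox_shift)
open AveragingDeficitNearIdentity (Ad_add Ad_real_smul)
open AveragingDeficitHSInner (nhsNormSq_Ad nhsNormSq_smul)
open NE3CovariantCalculus (hsR hsR_self nhsNormSq_sub)
open NE3LandauOrbit (nhsNormSq_add)
open NE3FrameFreeDecompositionPrep (hsR_smul_left hsR_smul_right)
open NE3BlockLineAverage (sum_univ_boxVec sum_periodBox_blocks)
open NE3StraightAverageAdjoint (cdiv_cmod_block)
open NE3CovariantLineAdjoint
open NE7LineSumGramBounds (two_mul_sum_succ six_mul_sum_succ_sq)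
open SkeletonLattice (cdiv cmod cmod_nonneg cmod_lt)

noncomputable section

variable {d : ℕ} {n : Type*} [Fintype n] [DecidableEq n]

/-! ## §1 The pointwise AM–GM step in the Hilbert–Schmidt currency -/

/-- `‖pX + qY‖² = p²‖X‖² + q²‖Y‖² + 2pq·hsR X Y` (normalised Hilbert–Schmidt). [folklore] -/
theorem nhsNormSq_weighted_eq (p q : ℝ) (X Y : Matrix n n ℂ) :
    nhsNormSq (p • X + q • Y) = p ^ 2 * nhsNormSq X + q ^ 2 * nhsNormSq Y + 2 * (p * q) * hsR X Y := by
  rw [nhsNormSq_add, nhsNormSq_smul, nhsNormSq_smul, hsR_smul_left, hsR_smul_right]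
  ring

/-- `−(‖X‖² + ‖Y‖²) ≤ 2·hsR X Y` (from `‖X + Y‖² ≥ 0`). [folklore] -/
theorem neg_le_two_hsR (X Y : Matrix n n ℂ) : -(nhsNormSq X + nhsNormSq Y) ≤ 2 * hsR X Y := by
  have h := nhsNormSq_nonneg (X + Y)
  rw [nhsNormSq_add] at h
  linarith

omit [DecidableEq n] in
/-- `2·hsR X Y ≤ ‖X‖² + ‖Y‖²` (from `‖X − Y‖² ≥ 0`). [folklore] -/
theorem two_hsR_le (X Y : Matrix n n ℂ) : 2 * hsR X Y ≤ nhsNormSq X + nhsNormSq Y := by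
  have h := nhsNormSq_nonneg (X - Y)
  rw [nhsNormSq_sub] at h
  linarith

/-- **POINTWISE LOWER BOUND**: for `p, q ≥ 0`, `p(p−q)‖X‖² + q(q−p)‖Y‖² ≤ ‖pX + qY‖²` (AM–GM on the cross term). [folklore] -/
theorem nhsNormSq_weighted_lower {p q : ℝ} (hp : 0 ≤ p) (hq : 0 ≤ q) (X Y : Matrix n n ℂ) :
    p * (p - q) * nhsNormSq X + q * (q - p) * nhsNormSq Y ≤ nhsNormSq (p • X + q • Y) := by
  rw [nhsNormSq_weighted_eq]
  have hpq : 0 ≤ p * q := mul_nonneg hp hq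
  nlinarith [mul_le_mul_of_nonneg_left (neg_le_two_hsR X Y) hpq]

/-- **POINTWISE UPPER BOUND**: for `p, q ≥ 0`, `‖pX + qY‖² ≤ p(p+q)‖X‖² + q(p+q)‖Y‖²`. [folklore] -/
theorem nhsNormSq_weighted_upper {p q : ℝ} (hp : 0 ≤ p) (hq : 0 ≤ q) (X Y : Matrix n n ℂ) :
    nhsNormSq (p • X + q • Y) ≤ p * (p + q) * nhsNormSq X + q * (p + q) * nhsNormSq Y := by
  rw [nhsNormSq_weighted_eq]
  have hpq : 0 ≤ p * q := mul_nonneg hp hq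
  nlinarith [mul_le_mul_of_nonneg_left (two_hsR_le X Y) hpq]

/-! ## §2 The κ-last comb: all copies through a fine bond from one block share their transport -/

omit [Fintype n] [DecidableEq n] in
/-- The comb word to a copy shifted along `κ`: `klastWord κ (v + t•e_κ) i = treeWord (v − v_κ e_κ) ++ seg κ (v_κ + t + i)` — the transverse tree
is unchanged and the `κ`-run absorbs the shift. [folklore] -/
theorem klastWord_add_smul (κ : Fin d) (v : Site d) (t : ℤ) (i : ℕ) :
    klastWord κ (v + t • e κ) i = treeWord (v - v κ • e κ) ++ seg κ (v κ + t + (i : ℤ)) := by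
  unfold klastWord
  have h1 : (v + t • e κ) κ = v κ + t := by
    simp only [Pi.add_apply, Pi.smul_apply, e_apply, if_true, smul_eq_mul, mul_one]
  have h2 : (v + t • e κ) - (v + t • e κ) κ • e κ = v - v κ • e κ := by
    rw [h1]
    funext j
    simp only [Pi.add_apply, Pi.sub_apply, Pi.smul_apply, e_apply, smul_eq_mul]
    split_ifs <;> ring
  rw [h2, h1]

omit [Fintype n] [DecidableEq n] in
/-- **THE COPIES FROM THE BLOCK OF `x` SHARE ONE WORD**: the comb word up to and including the bond of the copy started `i` steps before the
offset `r` is `klastWord κ r 1`, for every `i`. [folklore] -/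
theorem klastWord_sub_smul_succ (κ : Fin d) (r : Site d) (i : ℕ) :
    klastWord κ (r - (i : ℤ) • e κ) (i + 1) = klastWord κ r 1 := by
  have e1 : r - (i : ℤ) • e κ = r + (-(i : ℤ)) • e κ := by rw [neg_smul, sub_eq_add_neg]
  have e2 : r = r + (0 : ℤ) • e κ := by rw [zero_smul, add_zero]
  rw [e1, klastWord_add_smul]
  conv_rhs => rw [e2, klastWord_add_smul]
  congr 2
  push_cast
  ring

omit [Fintype n] [DecidableEq n] in
/-- **THE COPIES FROM THE PREVIOUS BLOCK SHARE ONE WORD**: the comb word (from the previous corner) to the copy started `i` steps before the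
offset `r + M•e_κ` is `klastWord κ (r + M•e_κ) 1`, for every `i`. [folklore] -/
theorem klastWord_sub_smul_add_succ (κ : Fin d) (r : Site d) (M i : ℕ) :
    klastWord κ (r - (i : ℤ) • e κ + (M : ℤ) • e κ) (i + 1) = klastWord κ (r + (M : ℤ) • e κ) 1 := by
  have e1 : r - (i : ℤ) • e κ + (M : ℤ) • e κ = r + (-(i : ℤ) + (M : ℤ)) • e κ := by
    rw [add_smul, neg_smul, sub_eq_add_neg, add_assoc]
  rw [e1, klastWord_add_smul, klastWord_add_smul]
  congr 2
  push_cast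
  ring

/-- The comb frame of every copy through `x` from the block `z = cdiv M x` (offset `r − i•e_κ`, step `i`) is
`(W(M•z; klastWord κ r 1))⁻¹`. [folklore] -/
theorem combFrame_copy_same (W : Site d → Fin d → (Matrix n n ℂ)ˣ) (M : ℕ) (z : Site d) (κ : Fin d) (r : Site d) (i : ℕ) :
    combFrame W M z κ (r - (i : ℤ) • e κ) i = (hol W ((M : ℤ) • z) (klastWord κ r 1))⁻¹ := by
  unfold combFrame combTransport
  rw [klastWord_sub_smul_succ]

/-- The comb frame of every copy through `x` from the previous block `z − e_κ` (offset `r − i•e_κ + M•e_κ`, step `i`) is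
`(W(M•(z−e_κ); klastWord κ (r + M•e_κ) 1))⁻¹`. [folklore] -/
theorem combFrame_copy_prev (W : Site d → Fin d → (Matrix n n ℂ)ˣ) (M : ℕ) (z : Site d) (κ : Fin d) (r : Site d) (i : ℕ) :
    combFrame W M (z - e κ) κ (r - (i : ℤ) • e κ + (M : ℤ) • e κ) i
      = (hol W ((M : ℤ) • (z - e κ)) (klastWord κ (r + (M : ℤ) • e κ) 1))⁻¹ := by
  unfold combFrame combTransport
  rw [klastWord_sub_smul_add_succ]

/-! ## §3 The closed form of the adjoint for the comb frame family -/

/-- **THE ADJOINT OF THE COMB LINE SUM AT A FINE BOND** (`z = cdiv M x`, `r = cmod M x`): `WadWg M (combFrame W M) ω x κ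
 = (r_κ+1)•Ad_{A⁻¹} ω(z,κ) + (M−1−r_κ)•Ad_{B⁻¹} ω(z−e_κ,κ)`, `A = W(M•z; klastWord κ r 1)`, `B = W(M•(z−e_κ); klastWord κ (r+M•e_κ) 1)` —
the longitudinal linear interpolation of (69S) with ONE transport per coarse copy. [folklore] -/
theorem WadWg_combFrame_eq {M : ℕ} (hM : 1 ≤ M) (W : Site d → Fin d → (Matrix n n ℂ)ˣ) (ω : Site d → Fin d → Matrix n n ℂ)
    (x : Site d) (κ : Fin d) :
    WadWg M (combFrame W M) ω x κ
      = (((cmod M x κ : ℤ) : ℝ) + 1) • Ad (hol W ((M : ℤ) • cdiv M x) (klastWord κ (cmod M x) 1))⁻¹ (ω (cdiv M x) κ)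
        + ((M : ℝ) - 1 - ((cmod M x κ : ℤ) : ℝ))
          • Ad (hol W ((M : ℤ) • (cdiv M x - e κ)) (klastWord κ (cmod M x + (M : ℤ) • e κ) 1))⁻¹ (ω (cdiv M x - e κ) κ) := by
  rw [WadWg_eq hM]
  have h1 : ∀ i ∈ (range M).filter (fun i : ℕ => (i : ℤ) ≤ cmod M x κ),
      Ad (combFrame W M (cdiv M x) κ (cmod M x - (i : ℤ) • e κ) i) (ω (cdiv M x) κ)
        = Ad (hol W ((M : ℤ) • cdiv M x) (klastWord κ (cmod M x) 1))⁻¹ (ω (cdiv M x) κ) := by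
    intro i _
    rw [combFrame_copy_same]
  have h2 : ∀ i ∈ (range M).filter (fun i : ℕ => cmod M x κ < (i : ℤ)),
      Ad (combFrame W M (cdiv M x - e κ) κ (cmod M x - (i : ℤ) • e κ + (M : ℤ) • e κ) i) (ω (cdiv M x - e κ) κ)
        = Ad (hol W ((M : ℤ) • (cdiv M x - e κ)) (klastWord κ (cmod M x + (M : ℤ) • e κ) 1))⁻¹ (ω (cdiv M x - e κ) κ) := by
    intro i _
    rw [combFrame_copy_prev]
  rw [sum_congr rfl h1, sum_congr rfl h2, sum_const, sum_const, ← Nat.cast_smul_eq_nsmul ℝ, ← Nat.cast_smul_eq_nsmul ℝ,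
    card_filter_le_cmod hM, card_filter_cmod_lt hM]

/-! ## §4 The pointwise two-sided bound at a fine bond -/

omit [Fintype n] [DecidableEq n] in
/-- `0 ≤ r_κ(x)` and `r_κ(x) + 1 ≤ M` as reals. [folklore] -/
theorem cmod_real_bounds {M : ℕ} (hM : 1 ≤ M) (x : Site d) (κ : Fin d) :
    (0 : ℝ) ≤ ((cmod M x κ : ℤ) : ℝ) ∧ ((cmod M x κ : ℤ) : ℝ) + 1 ≤ (M : ℝ) := by
  have h0 := cmod_nonneg (L := M) hM x κ
  have h1 : (cmod M x κ : ℤ) + 1 ≤ (M : ℤ) := cmod_lt (L := M) hM x κ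
  exact ⟨by exact_mod_cast h0, by exact_mod_cast h1⟩

/-- **LOWER, POINTWISE**: with `p = r_κ+1`, `q = M−1−r_κ`:
`p(p−q)·nhsNormSq (ω z κ) + q(q−p)·nhsNormSq (ω (z−e_κ) κ) ≤ nhsNormSq (WadWg M (combFrame W M) ω x κ)` (unitary `W`). [folklore] -/
theorem nhsNormSq_WadWg_combFrame_lower {M : ℕ} (hM : 1 ≤ M) {W : Site d → Fin d → (Matrix n n ℂ)ˣ} (hW : IsUnitaryCfg W)
    (ω : Site d → Fin d → Matrix n n ℂ) (x : Site d) (κ : Fin d) :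
    (((cmod M x κ : ℤ) : ℝ) + 1) * ((((cmod M x κ : ℤ) : ℝ) + 1) - ((M : ℝ) - 1 - ((cmod M x κ : ℤ) : ℝ))) * nhsNormSq (ω (cdiv M x) κ)
        + ((M : ℝ) - 1 - ((cmod M x κ : ℤ) : ℝ)) * (((M : ℝ) - 1 - ((cmod M x κ : ℤ) : ℝ)) - (((cmod M x κ : ℤ) : ℝ) + 1))
          * nhsNormSq (ω (cdiv M x - e κ) κ)
      ≤ nhsNormSq (WadWg M (combFrame W M) ω x κ) := by
  obtain ⟨hr0, hrM⟩ := cmod_real_bounds hM x κ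
  have hA := (unitaryUnits (Matrix n n ℂ)).inv_mem (hol_mem_of hW ((M : ℤ) • cdiv M x) (klastWord κ (cmod M x) 1))
  have hB := (unitaryUnits (Matrix n n ℂ)).inv_mem (hol_mem_of hW ((M : ℤ) • (cdiv M x - e κ)) (klastWord κ (cmod M x + (M : ℤ) • e κ) 1))
  rw [WadWg_combFrame_eq hM, ← nhsNormSq_Ad hA (ω (cdiv M x) κ), ← nhsNormSq_Ad hB (ω (cdiv M x - e κ) κ)]
  exact nhsNormSq_weighted_lower (by linarith) (by linarith) _ _

/-- **UPPER, POINTWISE**: `nhsNormSq (WadWg M (combFrame W M) ω x κ) ≤ p·M·nhsNormSq (ω z κ) + q·M·nhsNormSq (ω (z−e_κ) κ)`. [folklore] -/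
theorem nhsNormSq_WadWg_combFrame_upper {M : ℕ} (hM : 1 ≤ M) {W : Site d → Fin d → (Matrix n n ℂ)ˣ} (hW : IsUnitaryCfg W)
    (ω : Site d → Fin d → Matrix n n ℂ) (x : Site d) (κ : Fin d) :
    nhsNormSq (WadWg M (combFrame W M) ω x κ)
      ≤ (((cmod M x κ : ℤ) : ℝ) + 1) * (M : ℝ) * nhsNormSq (ω (cdiv M x) κ)
        + ((M : ℝ) - 1 - ((cmod M x κ : ℤ) : ℝ)) * (M : ℝ) * nhsNormSq (ω (cdiv M x - e κ) κ) := by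
  obtain ⟨hr0, hrM⟩ := cmod_real_bounds hM x κ
  have hA := (unitaryUnits (Matrix n n ℂ)).inv_mem (hol_mem_of hW ((M : ℤ) • cdiv M x) (klastWord κ (cmod M x) 1))
  have hB := (unitaryUnits (Matrix n n ℂ)).inv_mem (hol_mem_of hW ((M : ℤ) • (cdiv M x - e κ)) (klastWord κ (cmod M x + (M : ℤ) • e κ) 1))
  rw [WadWg_combFrame_eq hM]
  have h := nhsNormSq_weighted_upper (p := ((cmod M x κ : ℤ) : ℝ) + 1) (q := (M : ℝ) - 1 - ((cmod M x κ : ℤ) : ℝ)) (by linarith)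
    (by linarith) (Ad (hol W ((M : ℤ) • cdiv M x) (klastWord κ (cmod M x) 1))⁻¹ (ω (cdiv M x) κ))
    (Ad (hol W ((M : ℤ) • (cdiv M x - e κ)) (klastWord κ (cmod M x + (M : ℤ) • e κ) 1))⁻¹ (ω (cdiv M x - e κ) κ))
  rw [nhsNormSq_Ad hA, nhsNormSq_Ad hB] at h
  have e1 : (((cmod M x κ : ℤ) : ℝ) + 1) + ((M : ℝ) - 1 - ((cmod M x κ : ℤ) : ℝ)) = (M : ℝ) := by ring
  rw [e1] at h
  exact h

/-! ## §5 Torus bookkeeping: the transverse count, the block tiling, the weight sums -/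

omit [Fintype n] [DecidableEq n] in
/-- **THE TRANSVERSE COUNT**: `Σ_{v∈[0,M)^d} φ(v_κ) = M^{d−1}·Σ_{s<M} φ(s)`. [folklore] -/
theorem sum_periodBox_coord (M : ℕ) (κ : Fin d) (φ : ℤ → ℝ) :
    ∑ v ∈ periodBox (d := d) M, φ (v κ) = (M : ℝ) ^ (d - 1) * ∑ s ∈ range M, φ (s : ℤ) := by
  rw [← sum_univ_boxVec M (fun v => φ (v κ)),
    Fintype.sum_equiv (Equiv.funSplitAt κ (Fin M)) (fun r : Fin d → Fin M => φ (boxVec M r κ))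
      (fun p : Fin M × ({j : Fin d // j ≠ κ} → Fin M) => φ ((p.1 : ℕ) : ℤ)) (fun r => rfl),
    Fintype.sum_prod_type]
  simp only [Finset.sum_const, Finset.card_univ]
  have hcard : Fintype.card ({j : Fin d // j ≠ κ} → Fin M) = M ^ (d - 1) := by
    rw [Fintype.card_fun, Fintype.card_fin, Fintype.card_subtype_compl, Fintype.card_fin, Fintype.card_unique]
  rw [hcard, Finset.mul_sum, ← Fin.sum_univ_eq_sum_range (fun s : ℕ => (M : ℝ) ^ (d - 1) * φ (s : ℤ)) M]
  refine Fintype.sum_congr _ _ fun a => ?_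
  rw [nsmul_eq_mul]
  push_cast
  ring

omit [Fintype n] [DecidableEq n] in
/-- **BLOCK TILING WITH A LONGITUDINAL WEIGHT**: `Σ_{x∈periodBox (M·N)} φ(r_κ(x))·ψ(z(x)) = (M^{d−1}·Σ_{s<M} φ s)·Σ_{z∈periodBox N} ψ z`
(`z = cdiv M x`, `r = cmod M x`). [folklore] -/
theorem sum_periodBox_weight_mul {M : ℕ} (hM : 1 ≤ M) (N : ℕ) (κ : Fin d) (φ : ℤ → ℝ) (ψ : Site d → ℝ) :
    ∑ x ∈ periodBox (d := d) (M * N), φ (cmod M x κ) * ψ (cdiv M x)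
      = ((M : ℝ) ^ (d - 1) * ∑ s ∈ range M, φ (s : ℤ)) * ∑ z ∈ periodBox (d := d) N, ψ z := by
  rw [← sum_periodBox_blocks M N hM, Finset.mul_sum]
  refine sum_congr rfl fun z _ => ?_
  have h : ∀ v ∈ periodBox (d := d) M,
      φ (cmod M ((M : ℤ) • z + v) κ) * ψ (cdiv M ((M : ℤ) • z + v)) = φ (v κ) * ψ z := by
    intro v hv
    obtain ⟨h1, h2⟩ := cdiv_cmod_block (M := M) (z := z) hv
    rw [h1, h2]
  rw [sum_congr rfl h, ← Finset.sum_mul, sum_periodBox_coord]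

omit [Fintype n] [DecidableEq n] in
/-- **THE LOWER WEIGHT SUMS**: `Σ_{s<M} (s+1)((s+1)−(M−1−s)) + Σ_{s<M} (M−1−s)((M−1−s)−(s+1)) = M(M+1)(M+2)∕6 + M(M−1)(M−2)∕6 = M(M²+2)∕3`.
[folklore] -/
theorem sum_weights_lower (M : ℕ) :
    ∑ s ∈ range M, ((((s : ℕ) : ℤ) : ℝ) + 1) * (((((s : ℕ) : ℤ) : ℝ) + 1) - ((M : ℝ) - 1 - (((s : ℕ) : ℤ) : ℝ)))
        + ∑ s ∈ range M, ((M : ℝ) - 1 - (((s : ℕ) : ℤ) : ℝ)) * (((M : ℝ) - 1 - (((s : ℕ) : ℤ) : ℝ)) - ((((s : ℕ) : ℤ) : ℝ) + 1))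
      = (M : ℝ) * ((M : ℝ) ^ 2 + 2) / 3 := by
  have h1 := two_mul_sum_succ M
  have h2 := six_mul_sum_succ_sq M
  have h3 : ∑ s ∈ range M, ((s : ℝ) + 1) = ∑ s ∈ range M, (s : ℝ) + (M : ℝ) := by
    rw [Finset.sum_add_distrib, Finset.sum_const, Finset.card_range, nsmul_eq_mul, mul_one]
  have e1 : ∀ s : ℕ, ((((s : ℕ) : ℤ) : ℝ) + 1) * (((((s : ℕ) : ℤ) : ℝ) + 1) - ((M : ℝ) - 1 - (((s : ℕ) : ℤ) : ℝ)))
      = 2 * ((s : ℝ) + 1) ^ 2 - (M : ℝ) * ((s : ℝ) + 1) := by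
    intro s; push_cast; ring
  have e2 : ∀ s : ℕ, ((M : ℝ) - 1 - (((s : ℕ) : ℤ) : ℝ)) * (((M : ℝ) - 1 - (((s : ℕ) : ℤ) : ℝ)) - ((((s : ℕ) : ℤ) : ℝ) + 1))
      = 2 * ((s : ℝ) + 1) ^ 2 - 3 * (M : ℝ) * ((s : ℝ) + 1) + (M : ℝ) ^ 2 := by
    intro s; push_cast; ring
  simp only [e1, e2, Finset.sum_add_distrib, Finset.sum_sub_distrib, ← Finset.mul_sum, Finset.sum_const, Finset.card_range,
    nsmul_eq_mul]
  linear_combination (2 / 3 : ℝ) * h2 - 2 * (M : ℝ) * h1 + 4 * (M : ℝ) * h3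

omit [Fintype n] [DecidableEq n] in
/-- **THE UPPER WEIGHT SUMS**: `Σ_{s<M} (s+1)·M + Σ_{s<M} (M−1−s)·M = M³`. [folklore] -/
theorem sum_weights_upper (M : ℕ) :
    ∑ s ∈ range M, ((((s : ℕ) : ℤ) : ℝ) + 1) * (M : ℝ) + ∑ s ∈ range M, ((M : ℝ) - 1 - (((s : ℕ) : ℤ) : ℝ)) * (M : ℝ)
      = (M : ℝ) ^ 3 := by
  rw [← Finset.sum_add_distrib]
  have e : ∀ s : ℕ, ((((s : ℕ) : ℤ) : ℝ) + 1) * (M : ℝ) + ((M : ℝ) - 1 - (((s : ℕ) : ℤ) : ℝ)) * (M : ℝ) = (M : ℝ) ^ 2 := by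
    intro s; ring
  simp only [e, Finset.sum_const, Finset.card_range, nsmul_eq_mul]
  ring

/-! ## §6 The two-sided Gram bound of the comb line sum at ANY unitary background -/

omit [DecidableEq n] in
/-- The coarse periodic shift: `Σ_{z∈periodBox N} nhsNormSq (ω (z−e_κ) κ) = Σ_z nhsNormSq (ω z κ)` for `N`-periodic `ω`. [folklore] -/
theorem sum_nhsNormSq_shift {N : ℕ} (hN : 1 ≤ N) (ω : Site d → Fin d → Matrix n n ℂ)
    (hω : ∀ (z : Site d) (τ μ : Fin d), ω (z + (N : ℤ) • e τ) μ = ω z μ) (κ : Fin d) :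
    ∑ z ∈ periodBox (d := d) N, nhsNormSq (ω (z - e κ) κ) = ∑ z ∈ periodBox (d := d) N, nhsNormSq (ω z κ) := by
  have h := sum_periodBox_shift (d := d) N hN (g := fun z => nhsNormSq (ω z κ)) (fun z τ => by simp only [hω]) (-e κ)
  simpa only [sub_eq_add_neg] using h

/-- **LOWER GRAM BOUND, ONE DIRECTION**: for unitary `W`, `N`-periodic `ω`, `M, N ≥ 1`, every `κ`:
`M^{d−1}·M(M²+2)∕3·Σ_{z∈periodBox N} nhsNormSq (ω z κ) ≤ Σ_{x∈periodBox (M·N)} nhsNormSq (WadWg M (combFrame W M) ω x κ)`. [folklore] -/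
theorem sum_nhsNormSq_WadWg_combFrame_lower_dir {M N : ℕ} (hM : 1 ≤ M) (hN : 1 ≤ N) {W : Site d → Fin d → (Matrix n n ℂ)ˣ}
    (hW : IsUnitaryCfg W) (ω : Site d → Fin d → Matrix n n ℂ) (hω : ∀ (z : Site d) (τ μ : Fin d), ω (z + (N : ℤ) • e τ) μ = ω z μ)
    (κ : Fin d) :
    (M : ℝ) ^ (d - 1) * ((M : ℝ) * ((M : ℝ) ^ 2 + 2) / 3) * ∑ z ∈ periodBox (d := d) N, nhsNormSq (ω z κ)
      ≤ ∑ x ∈ periodBox (d := d) (M * N), nhsNormSq (WadWg M (combFrame W M) ω x κ) := by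
  have hpt := fun x (_ : x ∈ periodBox (d := d) (M * N)) => nhsNormSq_WadWg_combFrame_lower hM hW ω x κ
  refine le_trans (le_of_eq ?_) (Finset.sum_le_sum hpt)
  rw [Finset.sum_add_distrib,
    sum_periodBox_weight_mul hM N κ (fun t : ℤ => ((t : ℝ) + 1) * (((t : ℝ) + 1) - ((M : ℝ) - 1 - (t : ℝ))))
      (fun z => nhsNormSq (ω z κ)),
    sum_periodBox_weight_mul hM N κ (fun t : ℤ => ((M : ℝ) - 1 - (t : ℝ)) * (((M : ℝ) - 1 - (t : ℝ)) - ((t : ℝ) + 1)))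
      (fun z => nhsNormSq (ω (z - e κ) κ)),
    sum_nhsNormSq_shift hN ω hω κ, ← add_mul, ← mul_add, sum_weights_lower]

/-- **UPPER GRAM BOUND, ONE DIRECTION**: `Σ_{x∈periodBox (M·N)} nhsNormSq (WadWg M (combFrame W M) ω x κ) ≤ M^{d−1}·M³·Σ_{z∈periodBox N} nhsNormSq (ω z κ)`.
[folklore] -/
theorem sum_nhsNormSq_WadWg_combFrame_upper_dir {M N : ℕ} (hM : 1 ≤ M) (hN : 1 ≤ N) {W : Site d → Fin d → (Matrix n n ℂ)ˣ}
    (hW : IsUnitaryCfg W) (ω : Site d → Fin d → Matrix n n ℂ) (hω : ∀ (z : Site d) (τ μ : Fin d), ω (z + (N : ℤ) • e τ) μ = ω z μ)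
    (κ : Fin d) :
    ∑ x ∈ periodBox (d := d) (M * N), nhsNormSq (WadWg M (combFrame W M) ω x κ)
      ≤ (M : ℝ) ^ (d - 1) * (M : ℝ) ^ 3 * ∑ z ∈ periodBox (d := d) N, nhsNormSq (ω z κ) := by
  have hpt := fun x (_ : x ∈ periodBox (d := d) (M * N)) => nhsNormSq_WadWg_combFrame_upper hM hW ω x κ
  refine (Finset.sum_le_sum hpt).trans (le_of_eq ?_)
  rw [Finset.sum_add_distrib,
    sum_periodBox_weight_mul hM N κ (fun t : ℤ => ((t : ℝ) + 1) * (M : ℝ)) (fun z => nhsNormSq (ω z κ)),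
    sum_periodBox_weight_mul hM N κ (fun t : ℤ => ((M : ℝ) - 1 - (t : ℝ)) * (M : ℝ)) (fun z => nhsNormSq (ω (z - e κ) κ)),
    sum_nhsNormSq_shift hN ω hω κ, ← add_mul, ← mul_add, sum_weights_upper]

/-- **(α_S) AT ANY UNITARY BACKGROUND — THE LOWER GRAM BOUND OF THE COMB LINE SUM**: for unitary `W`, `N`-periodic coarse `ω`, `M, N ≥ 1`,
`M^{d−1}·M(M²+2)∕3 · Σ_{z∈periodBox N}Σ_κ nhsNormSq (ω z κ) ≤ Σ_{x∈periodBox (M·N)}Σ_κ nhsNormSq (WadWg M (combFrame W M) ω x κ)` — the flat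
symbol of `NE7LineSumGramBounds.lineSum_gram_lower` holds VERBATIM at a curved background (no small field). [folklore] -/
theorem sum_nhsNormSq_WadWg_combFrame_lower {M N : ℕ} (hM : 1 ≤ M) (hN : 1 ≤ N) {W : Site d → Fin d → (Matrix n n ℂ)ˣ}
    (hW : IsUnitaryCfg W) (ω : Site d → Fin d → Matrix n n ℂ) (hω : ∀ (z : Site d) (τ μ : Fin d), ω (z + (N : ℤ) • e τ) μ = ω z μ) :
    (M : ℝ) ^ (d - 1) * ((M : ℝ) * ((M : ℝ) ^ 2 + 2) / 3) * ∑ z ∈ periodBox (d := d) N, ∑ κ : Fin d, nhsNormSq (ω z κ)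
      ≤ ∑ x ∈ periodBox (d := d) (M * N), ∑ κ : Fin d, nhsNormSq (WadWg M (combFrame W M) ω x κ) := by
  calc (M : ℝ) ^ (d - 1) * ((M : ℝ) * ((M : ℝ) ^ 2 + 2) / 3) * ∑ z ∈ periodBox (d := d) N, ∑ κ : Fin d, nhsNormSq (ω z κ)
      = ∑ κ : Fin d, (M : ℝ) ^ (d - 1) * ((M : ℝ) * ((M : ℝ) ^ 2 + 2) / 3) * ∑ z ∈ periodBox (d := d) N, nhsNormSq (ω z κ) := by
        rw [Finset.sum_comm, Finset.mul_sum]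
    _ ≤ ∑ κ : Fin d, ∑ x ∈ periodBox (d := d) (M * N), nhsNormSq (WadWg M (combFrame W M) ω x κ) :=
        Finset.sum_le_sum fun κ _ => sum_nhsNormSq_WadWg_combFrame_lower_dir hM hN hW ω hω κ
    _ = ∑ x ∈ periodBox (d := d) (M * N), ∑ κ : Fin d, nhsNormSq (WadWg M (combFrame W M) ω x κ) := Finset.sum_comm

/-- **THE UPPER GRAM BOUND OF THE COMB LINE SUM**: `Σ_{x∈periodBox (M·N)}Σ_κ nhsNormSq (WadWg M (combFrame W M) ω x κ) ≤ M^{d−1}·M³·Σ_zΣ_κ nhsNormSq (ω z κ)`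
(unitary `W`, `N`-periodic `ω`; symbol ratio `Λ²∕λ = 3M²∕(M²+2) ≤ 3`). [folklore] -/
theorem sum_nhsNormSq_WadWg_combFrame_upper {M N : ℕ} (hM : 1 ≤ M) (hN : 1 ≤ N) {W : Site d → Fin d → (Matrix n n ℂ)ˣ}
    (hW : IsUnitaryCfg W) (ω : Site d → Fin d → Matrix n n ℂ) (hω : ∀ (z : Site d) (τ μ : Fin d), ω (z + (N : ℤ) • e τ) μ = ω z μ) :
    ∑ x ∈ periodBox (d := d) (M * N), ∑ κ : Fin d, nhsNormSq (WadWg M (combFrame W M) ω x κ)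
      ≤ (M : ℝ) ^ (d - 1) * (M : ℝ) ^ 3 * ∑ z ∈ periodBox (d := d) N, ∑ κ : Fin d, nhsNormSq (ω z κ) := by
  calc ∑ x ∈ periodBox (d := d) (M * N), ∑ κ : Fin d, nhsNormSq (WadWg M (combFrame W M) ω x κ)
      = ∑ κ : Fin d, ∑ x ∈ periodBox (d := d) (M * N), nhsNormSq (WadWg M (combFrame W M) ω x κ) := Finset.sum_comm
    _ ≤ ∑ κ : Fin d, (M : ℝ) ^ (d - 1) * (M : ℝ) ^ 3 * ∑ z ∈ periodBox (d := d) N, nhsNormSq (ω z κ) :=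
        Finset.sum_le_sum fun κ _ => sum_nhsNormSq_WadWg_combFrame_upper_dir hM hN hW ω hω κ
    _ = (M : ℝ) ^ (d - 1) * (M : ℝ) ^ 3 * ∑ z ∈ periodBox (d := d) N, ∑ κ : Fin d, nhsNormSq (ω z κ) := by
        rw [Finset.sum_comm, Finset.mul_sum]

end

end Summit.QuantumFields.BalabanUV.T4Continuum.NE7CombLineSumGramBounds
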